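import Mathlib
import HarnessLib
import Summits.QuantumFields.YangMills.Theses.PencilRigidity
import Summits.QuantumFields.YangMills.Theorems.PencilRigidityCurvatureKernelBoundKernelConclusionOfWitnessLocalDecay

/-!
# ROUTE-EDIT PROPOSAL (compiled, for the planner) — fold the UV datum of `CurvatureKernelBound` into the existence leg

Lead c6 of crux stmt-QuantumFields-11687 (`PencilRigidity.CurvatureKernelBound`). Six consecutive line leads (c0–c6) have reduced
the crux to the open UV construction and recommended consuming it PER WITNESS. This file is the turnkey version of that
recommendation: it states `WeakCouplingHypercubicLimitUV` — the route's existence leg `WeakCouplingHypercubicLimit`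
(stmt-QuantumFields-16120) with ONE extra conjunct, the two-point local decay T of the witness's curvature channel (inserted right
after the one-field-gauge clause; every other clause byte-identical) — and proves `closes_fold`, the route's deciding theorem with the
hypothesis `hKB : CurvatureKernelBound` DELETED, from the landed fold `KernelConclusionOfWitnessLocalDecay` (p131920). The body is the
tree's `closes` verbatim except for the two marked lines. A planner adopting it: (1) `set-signature` / restate item 16120 as
`WeakCouplingHypercubicLimitUV` below (or file it as a new item superseding 16120), (2) `route edit --closes-file` with `closes_fold`,
(3) drop `CurvatureKernelBound` (11687) from the closes chain — it then leaves the route as CHARACTERISED (tree theorems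
`CurvatureKernelBoundIffLocalDecay`, `…IffSmearedEventually`, `…IffSmearedFrequently`) rather than open. The lattice-currency
alternative replaces the T conjunct by the frequent pure-`L∞` smeared bound and the fold by `KernelConclusionOfWitnessSmearedFrequently`.
-/

namespace Summit.QuantumFields.YangMills.Theses.PencilRigidity.FoldProposal

open Summit.QuantumFields.YangMills.Theses.PencilRigidity

/-- **PROPOSED existence leg with the UV datum folded in** (T currency): `WeakCouplingHypercubicLimit` ∧ [for the witness's curvature
channel `S₁ n := S n (fun _ => r.curvature)`: local two-point bounds `‖S₁ 2 (f 0 ⊗ f 1)‖ ≤ A ‖f 0‖₁ ‖f 1‖₁ + B t⁸ ‖f 0‖∞ ‖f 1‖∞` about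
`∓s e₀` with `A + B ≤ C s^(η−10)`, `s ∈ (0, s₁)`]. Whoever constructs the witness (Bałaban-type UV analysis at `β_k → ∞`) supplies it;
asymptotic freedom predicts `η = 2`. -/
def WeakCouplingHypercubicLimitUV : Prop :=
  open Literature.MathematicalPhysics.QuantumLattice Literature.MathematicalPhysics.AQFT Literature.MathematicalPhysics.QuantumFieldTheory in let E := EuclideanSpace ℝ (Fin 4); ∀ (G : Type) [Group G] [TopologicalSpace G] [IsTopologicalGroup G] [CompactSpace G], IsCompactSimpleLieGroup G → letI : MeasurableSpace G := borel G; haveI : BorelSpace G := ⟨rfl⟩; ∃ (r : LatticeRep G) (sch : SpeciesScheme (YMSpecies G)) (S : LabelledSchwingerFamily (YMSpecies G) (E)), sch.HasWeakCouplingLimit ∧ (∀ (n : ℕ) (k : Fin n → YMSpecies G), (∃ i, k i ≠ r.curvature) → ∀ F : SchwartzMap (Fin n → E) ℂ, S n k F = 0) ∧ (∃ (C η s₁ : ℝ), 0 < η ∧ 0 < s₁ ∧ (∀ (s : ℝ), 0 < s → s < s₁ → ∃ (r₀ A B : ℝ), 0 < r₀ ∧ 0 ≤ A ∧ 0 ≤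 B ∧ A + B ≤ C * s ^ (η - 10) ∧ (∀ (t : ℝ), 0 < t → t ≤ r₀ → ∀ (f : Fin 2 → SchwartzMap (EuclideanSpace ℝ (Fin 4)) ℝ) (F : SchwartzMap (Fin 2 → (EuclideanSpace ℝ (Fin 4))) ℂ) (M₀ M₁ : ℝ), IsTensorOf F (fun i => ofRealTest (f i)) → tsupport ((f 0 : SchwartzMap (EuclideanSpace ℝ (Fin 4)) ℝ) : (EuclideanSpace ℝ (Fin 4)) → ℝ) ⊆ Metric.closedBall (EuclideanSpace.single (0 : Fin 4) (-s)) t → tsupport ((f 1 : SchwartzMap (EuclideanSpace ℝ (Fin 4)) ℝ) : (EuclideanSpace ℝ (Fin 4)) → ℝ) ⊆ Metric.closedBall (EuclideanSpace.single (0 : Fin 4) s) t → (∀ x, |f 0 x| ≤ M₀) → (∀ x, |f 1 x| ≤ M₁) → ‖S 2 (fun _ => r.curvature) F‖ ≤ A * (∫ x : (EuclideanSpace ℝ (Fin 4)), |f 0 x|) * (∫ x : (EuclideanSpace ℝ (Fin 4)), |f 1 x|) + B * t ^ 8 * M₀ * M₁))) ∧ (S.IsNormalized ∧ S.IsHermitian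 ∧ S.HasLinearGrowth ∧ S.IsReflectionPositive ∧ S.IsSymmetric ∧ S.HasClusterProperty ∧ (∀ (n : ℕ) (k : Fin n → YMSpecies G) (a : E) (F : SchwartzMap (Fin n → E) ℂ), IsOffDiagonal F → S n k (translateMulti a F) = S n k F) ∧ (∀ (n : ℕ) (k : Fin n → YMSpecies G) (R : E ≃ₗᵢ[ℝ] E), LinearMap.det (R.toLinearEquiv : E →ₗ[ℝ] E) = 1 → (∀ i : Fin 4, ∃ j : Fin 4, R (EuclideanSpace.single i 1) = EuclideanSpace.single j 1 ∨ R (EuclideanSpace.single i 1) = -EuclideanSpace.single j 1) → ∀ F : SchwartzMap (Fin n → E) ℂ, IsOffDiagonal F → S n k (linActMulti R F) = S n k F)) ∧ (∀ (n : ℕ), n ≠ 0 → ∀ (σ : Fin n → YMSpecies G) (f : Fin n → SchwartzMap (E) ℝ) (F : SchwartzMap (Fin n → E) ℂ), IsTensorOf F (fun i => ofRealTest (f i)) → IsOffDiagonal F → Filter.Tendsto (fun k : ℕ => ((latticeSchwinger r.ρ sch (fun s => s.F) k n σ f : ℝ) : ℂ)) Filter.atTop (nhds (S n σ F))) ∧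 (∃ (F₁ G₁ : SchwartzMap (Fin 1 → E) ℂ) (H₁ : SchwartzMap (Fin (1 + 1) → E) ℂ), IsTimeOrdered F₁ ∧ IsTimeOrdered G₁ ∧ IsAppendTensorOf H₁ (osAdjoint F₁) G₁ ∧ S (1 + 1) (fun _ => r.curvature) H₁ ≠ S 1 (fun _ => r.curvature) (osAdjoint F₁) * S 1 (fun _ => r.curvature) G₁) ∧ (∃ (f g h : SchwartzMap (E) ℂ) (Ffgh : SchwartzMap (Fin 3 → E) ℂ) (Fgh Ffh Ffg : SchwartzMap (Fin 2 → E) ℂ) (Ff Fg Fh : SchwartzMap (Fin 1 → E) ℂ), IsTensorOf Ffgh ![f, g, h] ∧ IsOffDiagonal Ffgh ∧ IsTensorOf Fgh ![g, h] ∧ IsTensorOf Ffh ![f, h] ∧ IsTensorOf Ffg ![f, g] ∧ IsTensorOf Ff ![f] ∧ IsTensorOf Fg ![g] ∧ IsTensorOf Fh ![h] ∧ S 3 (fun _ => r.curvature) Ffgh - S 1 (fun _ => r.curvature) Ff * S 2 (fun _ => r.curvature) Fgh - S 1 (fun _ => r.curvature) Fg * S 2 (fun _ => r.curvature) Ffh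 - S 1 (fun _ => r.curvature) Fh * S 2 (fun _ => r.curvature) Ffg + 2 * (S 1 (fun _ => r.curvature) Ff * S 1 (fun _ => r.curvature) Fg * S 1 (fun _ => r.curvature) Fh) ≠ 0) ∧ (∃ Δ : ℝ, 0 < Δ ∧ S.HasMassGap Δ ∧ HasLatticeMassGap r sch Δ)

/-- **PROPOSED deciding theorem**: the tree's `closes` with `hKB : CurvatureKernelBound` removed and `hWHL` re-typed; the kernel of the
curvature channel now comes from the per-witness fold `KernelConclusionOfWitnessLocalDecay` (the two lines marked `-- FOLD`). -/
theorem closes_fold (hSR : ShellRigidity) (hNP : NPointIsotropy)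
    (hDiag : DiagonalMirrorRPR) (hWHL : WeakCouplingHypercubicLimitUV) (hCC : CurvatureChannel)
    (hKT : KernelTransfer) (hPE : PlanarToEuclidean) : YangMills := by
  intro G i1 i2 i3 i4 hG
  letI : MeasurableSpace G := borel G
  haveI : BorelSpace G := ⟨rfl⟩
  obtain ⟨r, sch, S, hweak, hzero, hUV, hW⟩ := hWHL G hG   -- FOLD: one more component `hUV`
  obtain ⟨hW₁, hAxis⟩ := hCC G hG r sch S hW
  obtain ⟨hconv₁, hpkg₁, htr₁, hhyp₁, Δ₁, hΔ₁, hgap₁, hlat₁⟩ := hW₁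
  have h8 : ∀ (R : EuclideanSpace ℝ (Fin 4) ≃ₗᵢ[ℝ] EuclideanSpace ℝ (Fin 4)) (a b : ℝ), a ^ 2 + b ^ 2 = 1 →
      (a = 0 ∨ b = 0 ∨ a ^ 2 = b ^ 2) →
      R (EuclideanSpace.single 0 1) = a • EuclideanSpace.single 0 1 + b • EuclideanSpace.single 1 1 →
      (Literature.MathematicalPhysics.QuantumLattice.SchwingerFamily.toLabelled
        (fun n => (S n (fun _ => r.curvature)).comp
          (Literature.MathematicalPhysics.QuantumLattice.linActMulti R))).IsReflectionPositive := by
    intro R a b hab hcase hR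
    rcases hcase with h0 | h0 | h0
    · exact hAxis R a b hab (Or.inl h0) hR
    · exact hAxis R a b hab (Or.inr h0) hR
    · have ha : a ^ 2 = 1 / 2 := by linarith
      have hb : b ^ 2 = 1 / 2 := by linarith
      exact hDiag G hG r sch (fun n => S n (fun _ => r.curvature))
        ⟨hconv₁, hpkg₁, htr₁, hhyp₁, Δ₁, hΔ₁, hgap₁, hlat₁⟩ R a b ha hb hR
  obtain ⟨hnorm₁, hherm₁, hgrowth₁, hrp₁, hsymm₁, hclus₁⟩ := hpkg₁
  -- FOLD: UV input per witness — the real two-point kernel of the curvature channel from the witness's own decay clause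
  obtain ⟨K, C, η, hη, hcont, hbd, hrep⟩ :=
    Summit.QuantumFields.YangMills.Theorems.CurvatureKernel.KernelConclusionOfWitnessLocalDecay G hG r sch
      (fun n => S n (fun _ => r.curvature))
      ⟨hconv₁, ⟨hnorm₁, hherm₁, hgrowth₁, hrp₁, hsymm₁, hclus₁⟩, htr₁, hhyp₁, Δ₁, hΔ₁, hgap₁, hlat₁⟩ hUV
  obtain ⟨hB4, hpos0, hposD⟩ := hKT (fun n => S n (fun _ => r.curvature)) K hcont hrep hsymm₁ hhyp₁ h8
  have hiso := hSR K hcont ⟨C, η, hη, hbd⟩ hB4 hpos0 hposD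
  have hplanar := hNP G hG r sch (fun n => S n (fun _ => r.curvature))
    ⟨hconv₁, ⟨hnorm₁, hherm₁, hgrowth₁, hrp₁, hsymm₁, hclus₁⟩, htr₁, hhyp₁, Δ₁, hΔ₁, hgap₁, hlat₁⟩ h8
    ⟨K, hcont, hiso, hrep⟩
  obtain ⟨⟨hnorm, hherm, hgrowth, hrp, hsymm, hclus, htr, hhyp⟩, hconv, hnt, hng, Δ, hΔ, hgap, hlat⟩ := hW
  have hrot : ∀ (R : EuclideanSpace ℝ (Fin 4) ≃ₗᵢ[ℝ] EuclideanSpace ℝ (Fin 4)),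
      LinearMap.det (R.toLinearEquiv : EuclideanSpace ℝ (Fin 4) →ₗ[ℝ] EuclideanSpace ℝ (Fin 4)) = 1 →
      R (EuclideanSpace.single 2 1) = EuclideanSpace.single 2 1 →
      R (EuclideanSpace.single 3 1) = EuclideanSpace.single 3 1 →
      ∀ (n : ℕ) (k : Fin n → Literature.MathematicalPhysics.QuantumFieldTheory.YMSpecies G)
        (F : SchwartzMap (Fin n → EuclideanSpace ℝ (Fin 4)) ℂ),
        Literature.MathematicalPhysics.AQFT.IsOffDiagonal F →
          S n k (Literature.MathematicalPhysics.QuantumLattice.linActMulti R F) = S n k F := by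
    intro R hdet h2 h3 n k F hF
    by_cases hk : ∀ i, k i = r.curvature
    · have hk' : k = fun _ => r.curvature := funext hk
      subst hk'
      exact hplanar R hdet h2 h3 n F hF
    · push Not at hk
      exact (hzero n k hk _).trans (hzero n k hk _).symm
  have hE1 : S.IsEuclideanInvariant :=
    ⟨htr, fun n k R hdet F hF =>
      hPE (Literature.MathematicalPhysics.QuantumFieldTheory.YMSpecies G) S hhyp hrot n k R hdet F hF⟩
  exact ⟨r, sch, ⟨S, hnorm, hherm, hgrowth, hE1, hrp, hsymm, hclus⟩, hweak, hconv, hnt, hng, Δ, hΔ,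
    hgap, hlat⟩

/-- The folded existence leg implies the current one (drop the UV conjunct), so nothing downstream of item 16120 is lost. -/
theorem weakCouplingHypercubicLimit_of_UV (h : WeakCouplingHypercubicLimitUV) : WeakCouplingHypercubicLimit := by
  intro G i1 i2 i3 i4 hG
  obtain ⟨r, sch, S, hweak, hzero, -, hW⟩ := h G hG
  exact ⟨r, sch, S, hweak, hzero, hW⟩

end Summit.QuantumFields.YangMills.Theses.PencilRigidity.FoldProposal
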